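/-
Copyright: pub-hodgecm formalisation cell (harness21, 2026). New file (not vendored).
Origin: HOME/pub-hodgecm-pohl/lean/Pohl/FactorAct.lean — session planner-pub-hodgecm-pohl-0 (unit pub-hodgecm-pohl), part (b) `PohlmannSpan`.
Intended final place: `HodgeCM/Proofs/Pohlmann/FactorAct.lean` (module `HodgeCM.Proofs.Pohlmann.FactorAct`); WIP imports `Pohl.*` become the
`HodgeCM.*` modules named in the trailing comments.
Origin: expansion seat `planner-pub-hodgecm-pohl-0` (unit pub-hodgecm-pohl), handover v1 2026-08-18T03:16:01Z (`HOME/pub-hodgecm-pohl/lean/Pohl/FactorAct.lean`, md5 624ea18b);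
landed by the gen-5 packager as `HodgeCM/Proofs/Pohlmann/FactorAct.lean` (module `Pohl.FactorAct` → `HodgeCM.Proofs.Pohlmann.FactorAct`; body otherwise verbatim).
-/
import Summits.HodgeConjecture.HodgeCM.Geometry.WeightVectors
import Summits.HodgeConjecture.HodgeCM.Geometry.Facts

/-!
# Pohlmann's span theorem, III: factor-wise endomorphisms of `A′ = ∏_j A_{Θ_j}` exist

From the model facts M1 (`Fact_pull_id`, `Fact_pull_comp`), M18 (`Fact_lift`: the product has the
universal lifting property) and M24 (`Fact_cmEnd`: `𝓞_K` acts on `A_{(K,Φ)}` by genuine endomorphisms)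
we build, for every factor `j` and every algebraic integer `a ∈ 𝓞_F`, an endomorphism `M` of the
left-nested product `prodFin n X` acting on cohomology as `e^*` behind the `j`-th projection and
trivially behind the others (`exists_endo_prodFin`), hence a morphism with `IsFactorAct F Θ j a M`
(`exists_isFactorAct`).  In the intended model `M = id × ⋯ × a × ⋯ × id`.

Implementation note: `prodFin (n+1) X` is only DEFINITIONALLY `prod (prodFin n X') (X last)`, so all
auxiliary statements below pin the implicit variety arguments of `comp`/`pull` to `prodFin (n+1) X`.
-/

noncomputable section

namespace HodgeCM

namespace Universe

variable {U : Universe}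

open scoped NumberField

open Literature.AlgebraicGeometry.Motives (CMType)

/-- `pr_{last}` of an `(n+2)`-fold product is the second projection of the outer binary product. -/
theorem prj_last (n : ℕ) (X : Fin (n + 1 + 1) → U.Var) :
    U.prj (n + 1) X (Fin.last (n + 1)) =
      U.snd (U.prodFin n fun i => X i.castSucc) (X (Fin.last (n + 1))) := by
  simp [prj]

/-- `pr_i` (`i < last`) of an `(n+2)`-fold product factors through the first projection. -/
theorem prj_castSucc (n : ℕ) (X : Fin (n + 1 + 1) → U.Var) (i : Fin (n + 1)) :
    U.prj (n + 1) X i.castSucc =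
      U.comp (X := U.prodFin (n + 1) X)
        (U.fst (U.prodFin n fun i => X i.castSucc) (X (Fin.last (n + 1))))
        (U.prj n (fun i => X i.castSucc) i) := by
  simp [prj]

/-- `pr_0` of a one-fold product is the identity. -/
theorem prj_zero (X : Fin (0 + 1) → U.Var) :
    U.prj 0 X 0 = (U.idMor (X 0) : U.Mor (U.prodFin 0 X) (X 0)) := by
  show U.prj 0 X (Fin.last 0) = _
  simp only [prj, Fin.lastCases_last]

/-- The universal property of the outer binary product, with types pinned to `prodFin (n+1) X`. -/
theorem lift_prodFin (h18 : U.Fact_lift) (n : ℕ) (X : Fin (n + 1 + 1) → U.Var)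
    (f : U.Mor (U.prodFin (n + 1) X) (U.prodFin n fun i => X i.castSucc))
    (g : U.Mor (U.prodFin (n + 1) X) (X (Fin.last (n + 1)))) :
    ∃ M : U.Mor (U.prodFin (n + 1) X) (U.prodFin (n + 1) X),
      U.comp (Y := U.prodFin (n + 1) X) M
          (U.fst (U.prodFin n fun i => X i.castSucc) (X (Fin.last (n + 1)))) = f ∧
        U.comp (Y := U.prodFin (n + 1) X) M
          (U.snd (U.prodFin n fun i => X i.castSucc) (X (Fin.last (n + 1)))) = g :=
  h18 _ _ _ f g

/-- **Endomorphisms of one factor extend to the product** (on cohomology): for an endomorphism `e` of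
the `j`-th factor there is an endomorphism `M` of `∏_i X_i` with `M^* ∘ pr_j^* = pr_j^* ∘ e^*` and
`M^* ∘ pr_i^* = pr_i^*` for `i ≠ j`, in every degree.  Induction on `n` with `Fact_lift`. -/
theorem exists_endo_prodFin (h1 : U.Fact_pull_id) (h2 : U.Fact_pull_comp) (h18 : U.Fact_lift) :
    ∀ (n : ℕ) (X : Fin (n + 1) → U.Var) (j : Fin (n + 1)) (e : U.Mor (X j) (X j)),
      ∃ M : U.Mor (U.prodFin n X) (U.prodFin n X),
        (∀ k, U.pull M k ∘ₗ U.pull (U.prj n X j) k = U.pull (U.prj n X j) k ∘ₗ U.pull e k) ∧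
        ∀ i, i ≠ j → ∀ k, U.pull M k ∘ₗ U.pull (U.prj n X i) k = U.pull (U.prj n X i) k := by
  intro n
  induction n with
  | zero =>
    intro X j e
    have hj : j = 0 := Fin.fin_one_eq_zero j
    subst hj
    refine ⟨e, fun k => ?_, fun i hi => absurd (Fin.fin_one_eq_zero i) hi⟩
    have hid : ∀ y, U.pull (U.prj 0 X 0) k y = y := fun y => by
      rw [prj_zero]
      exact LinearMap.congr_fun (h1 (X 0) k) y
    refine LinearMap.ext fun y => ?_
    show U.pull e k (U.pull (U.prj 0 X 0) k y) = U.pull (U.prj 0 X 0) k (U.pull e k y)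
    rw [hid, hid]
  | succ n ih =>
    intro X j e
    obtain ⟨j, rfl⟩ | rfl := j.eq_castSucc_or_eq_last
    · -- the endomorphism lives on a factor of the inner product
      obtain ⟨M', hM'j, hM'i⟩ := ih (fun i => X i.castSucc) j e
      obtain ⟨M, hMfst, hMsnd⟩ := lift_prodFin h18 n X
        (U.comp (X := U.prodFin (n + 1) X)
          (U.fst (U.prodFin n fun i => X i.castSucc) (X (Fin.last (n + 1)))) M')
        (U.snd (U.prodFin n fun i => X i.castSucc) (X (Fin.last (n + 1))))
      refine ⟨M, fun k => ?_, fun i hi k => ?_⟩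
      · rw [prj_castSucc, h2, ← LinearMap.comp_assoc, ← h2 _ _ _ M, hMfst, h2,
          LinearMap.comp_assoc, hM'j k, ← LinearMap.comp_assoc]
      · obtain ⟨i, rfl⟩ | rfl := i.eq_castSucc_or_eq_last
        · have hij : i ≠ j := fun h => hi (by rw [h])
          rw [prj_castSucc, h2, ← LinearMap.comp_assoc, ← h2 _ _ _ M, hMfst, h2,
            LinearMap.comp_assoc, hM'i i hij k]
        · rw [prj_last, ← h2 _ _ _ M, hMsnd]
    · -- the endomorphism lives on the last factor
      obtain ⟨M, hMfst, hMsnd⟩ := lift_prodFin h18 n X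
        (U.fst (U.prodFin n fun i => X i.castSucc) (X (Fin.last (n + 1))))
        (U.comp (X := U.prodFin (n + 1) X)
          (U.snd (U.prodFin n fun i => X i.castSucc) (X (Fin.last (n + 1)))) e)
      refine ⟨M, fun k => ?_, fun i hi k => ?_⟩
      · rw [prj_last, ← h2 _ _ _ M, hMsnd, h2]
      · obtain ⟨i, rfl⟩ | rfl := i.eq_castSucc_or_eq_last
        · rw [prj_castSucc, h2, ← LinearMap.comp_assoc, ← h2 _ _ _ M, hMfst]
        · exact absurd rfl hi

/-- **Factor-wise CM multiplications exist**: for every factor `j` of `A′ = ∏_j A_{(F,Θ_j)}` and every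
algebraic integer `a ∈ 𝓞_F` there is an endomorphism `M` of `A′` with `IsFactorAct F Θ j a M`
(M1 + M18 + M24). -/
theorem exists_isFactorAct (M : U.ModelAxioms) (F : CMField) {n : ℕ} (Θ : Fin (n + 1) → CMType F)
    (j : Fin (n + 1)) (a : 𝓞 F) :
    ∃ Mj : U.Mor (U.cmProd F Θ) (U.cmProd F Θ), U.IsFactorAct F Θ j (a : F) Mj := by
  obtain ⟨e, he⟩ := M.cmEnd F (Θ j) a
  obtain ⟨Mj, hj, hi⟩ :=
    exists_endo_prodFin M.pull_id M.pull_comp M.lift n (fun i => U.cmAV F (Θ i)) j e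
  refine ⟨Mj, ?_, fun i hij => hi i hij 1⟩
  have h := hj 1
  rw [he] at h
  exact h

end Universe

end HodgeCM

end
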